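import Literature.Geometry.Symplectic.OrigamiFoldFirstOrder
import Literature.Geometry.Kaehler.ManifoldFormsEval
import Literature.Geometry.Manifold.FreeCircleAction
import Mathlib.Geometry.Manifold.ContMDiffMFDeriv
import HarnessLib

/-!
# The first-order coefficient on the orbit direction: smoothness in the base point and constant sign

Proofs companion of `OrigamiUnfolding.lean` (the named fact
`Literature.Geometry.Symplectic.exists_symplecticCutPieces_of_isOrigamiForm`, Cannas da
Silva–Guillemin–Pires, *Symplectic Origami*, IMRN 2011 = arXiv:0909.4065, Prop. 2.8), completing
step (S1b) (`OrigamiFoldFirstOrder.lean`: on the kernel-adapted collar `c` of the fold,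
`B₁(X_n) = ∂ₜ|₀ (c^*ω)_{(n,t)}((0,1),(X_n,0)) ≠ 0` for the generator `X` of the null circle
action).  Step (S1c) rescales `t` by `λ(n) = (2 / B₁(X_n))^{1/2}`, which needs `B₁(X_·)`
POSITIVE and regular in `n`; the orientation convention of Def. 2.2 ("the principal `S¹`-action
matches the induced orientation of the null foliation") is exactly the choice of `θ` versus
`θ⁻¹` making it positive.  Here:

* `contMDiff_prodSection` — a vector field on `N × ℝ` assembled from a smooth vector field on
  `N` and a constant vertical component is smooth (Mathlib's
  `contMDiff_equivTangentBundleProd_symm`, `contMDiff_vectorSpace_iff_contDiff`);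
* `mfderiv_circleOrbit_eq_mfderiv_actionMap`, **`contMDiff_circleOrbit_section`** — the orbit
  velocity field `n ↦ d/dt|₀ θ(e^{it}) n` of a smooth circle action is a smooth vector field (its
  fibre coordinates are those of the tangent map of the action map `(t, n) ↦ θ(e^{it}) n` along
  the smooth section `n ↦ ((0,n),(1,0))`);
* `deriv_eq_mfderiv_prod_real` — `∂ₜ F(n, t) = dF_{(n,t)}(0, 1)` for a `C^∞` `F` on `N × ℝ`;
* **`continuous_deriv_pullback_foldCollar_orbit`** — `n ↦ B₁(X_n)` is continuous: it is the
  derivative on `∂ₜ` along `N × {0}` of the smooth function `(c^*ω)(∂ₜ, X̃)`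
  (`IsSmoothForm.contMDiff_apply_sections`, `ManifoldFormsEval.lean`);
* **`IsFoldedForm.deriv_pullback_foldCollar_orbit_pos_or_neg`** — on a (pre)connected fold,
  `B₁(X_·)` is everywhere positive or everywhere negative (continuous and never zero,
  `IsFoldedForm.deriv_pullback_foldCollar_orbit_ne_zero`).

Everything here is proved; no definitions, no named facts (D-0026).

## References

* [CannasdasilvaGuilleminPires2010] A. Cannas da Silva, V. Guillemin, A. R. Pires, *Symplectic
  Origami*, IMRN 2011, 4252–4293 = arXiv:0909.4065, Def. 2.2 (orientation convention), proof of
  Prop. 2.8.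
* J. M. Lee, *Introduction to Smooth Manifolds*, 2nd ed. (2012), Prop. 14.26, Cor. 21.6 ff.
  [LeeSmoothManifolds2013]
-/

noncomputable section

open scoped Manifold ContDiff Topology
open Bundle Set Function Filter
open Literature.Geometry.Kaehler Literature.Topology.FourManifolds

namespace Literature.Geometry.Symplectic


section ProdFields

variable {E : Type*} [NormedAddCommGroup E] [NormedSpace ℝ E] {H : Type*} [TopologicalSpace H]
  {I : ModelWithCorners ℝ E H} {N : Type*} [TopologicalSpace N] [ChartedSpace H N]
  [IsManifold I ∞ N]

/-- **A vector field on `N × ℝ` assembled from a smooth vector field on `N` and a constant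
vertical component is smooth** (Mathlib's `contMDiff_equivTangentBundleProd_symm`: the
identification `TN × Tℝ ≅ T(N × ℝ)` is smooth). [folklore] -/
theorem contMDiff_prodSection {V : Π n : N, TangentSpace I n}
    (hV : ContMDiff I I.tangent ∞ (fun n => (⟨n, V n⟩ : TangentBundle I N))) (τ : ℝ) :
    ContMDiff (I.prod 𝓘(ℝ, ℝ)) (I.prod 𝓘(ℝ, ℝ)).tangent ∞
      (fun p : N × ℝ => (⟨p, (V p.1, τ)⟩ : TangentBundle (I.prod 𝓘(ℝ, ℝ)) (N × ℝ))) := by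
  -- the section of `Tℝ` with constant value `τ`
  have hτ : ContMDiff 𝓘(ℝ, ℝ) 𝓘(ℝ, ℝ).tangent ∞ (fun t : ℝ => (⟨t, τ⟩ : TangentBundle 𝓘(ℝ, ℝ) ℝ)) :=
    contMDiff_vectorSpace_iff_contDiff.2 contDiff_const
  have hpair : ContMDiff (I.prod 𝓘(ℝ, ℝ)) (I.tangent.prod 𝓘(ℝ, ℝ).tangent) ∞
      (fun p : N × ℝ => ((⟨p.1, V p.1⟩ : TangentBundle I N), (⟨p.2, τ⟩ : TangentBundle 𝓘(ℝ, ℝ) ℝ))) :=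
    (hV.comp contMDiff_fst).prodMk (hτ.comp contMDiff_snd)
  have h := (contMDiff_equivTangentBundleProd_symm (I := I) (M := N) (I' := 𝓘(ℝ, ℝ)) (M' := ℝ)
    (n := ∞)).comp hpair
  refine h.congr fun p => ?_
  rfl

end ProdFields

section OrbitField

variable {N : Type*} [TopologicalSpace N] [ChartedSpace (EuclideanSpace ℝ (Fin 3)) N]
  [IsManifold (𝓡 3) ∞ N]

omit [IsManifold (𝓡 3) ∞ N] in
/-- The orbit velocity of a smooth circle action is the differential of the action map
`(t, n) ↦ θ(e^{it}) n` on the vector `(1, 0)` at `(0, n)`. [folklore] -/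
theorem mfderiv_circleOrbit_eq_mfderiv_actionMap {θ : Circle → N → N}
    (hθ : ContMDiff ((𝓡 1).prod (𝓡 3)) (𝓡 3) ∞ (fun p : Circle × N => θ p.1 p.2)) (n : N) :
    mfderiv 𝓘(ℝ, ℝ) (𝓡 3) (fun t : ℝ => θ (Circle.exp t) n) 0 (1 : ℝ) =
      mfderiv (𝓘(ℝ, ℝ).prod (𝓡 3)) (𝓡 3) (fun p : ℝ × N => θ (Circle.exp p.1) p.2) (0, n)
        (((1 : ℝ), (0 : EuclideanSpace ℝ (Fin 3))) : ℝ × EuclideanSpace ℝ (Fin 3)) := by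
  set Θ : ℝ × N → N := fun p => θ (Circle.exp p.1) p.2 with hΘ
  have hΘs : ContMDiff (𝓘(ℝ, ℝ).prod (𝓡 3)) (𝓡 3) ∞ Θ :=
    hθ.comp (((contMDiff_circleExp (m := ∞)).comp contMDiff_fst).prodMk contMDiff_snd)
  have hι : HasMFDerivAt 𝓘(ℝ, ℝ) (𝓘(ℝ, ℝ).prod (𝓡 3)) (fun t : ℝ => ((t, n) : ℝ × N)) 0
      ((ContinuousLinearMap.id ℝ ℝ).prod (0 : ℝ →L[ℝ] EuclideanSpace ℝ (Fin 3))) :=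
    (hasMFDerivAt_id (0 : ℝ)).prodMk (hasMFDerivAt_const n (0 : ℝ))
  have hd : MDifferentiableAt (𝓘(ℝ, ℝ).prod (𝓡 3)) (𝓡 3) Θ (0, n) := hΘs.mdifferentiableAt (by norm_num)
  have hcomp := hd.hasMFDerivAt.comp 0 hι
  have heq : Θ ∘ (fun t : ℝ => ((t, n) : ℝ × N)) = fun t : ℝ => θ (Circle.exp t) n := rfl
  rw [heq] at hcomp
  have := congrArg (fun L => L (1 : ℝ)) hcomp.mfderiv
  exact this

/-- **The orbit velocity field of a smooth circle action is a smooth vector field**: its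
fibre coordinates in the trivialisation of `TN` at `n₀` are those of the smooth map
`n ↦ dΘ_{(0,n)}(1, 0)` (tangent map of the action map along a smooth section), read through the
same tangent coordinate change. [folklore] -/
theorem contMDiff_circleOrbit_section {θ : Circle → N → N}
    (hθ : ContMDiff ((𝓡 1).prod (𝓡 3)) (𝓡 3) ∞ (fun p : Circle × N => θ p.1 p.2))
    (h1 : ∀ n, θ 1 n = n) :
    ContMDiff (𝓡 3) (𝓡 3).tangent ∞ (fun n : N => (⟨n,
      mfderiv 𝓘(ℝ, ℝ) (𝓡 3) (fun t : ℝ => θ (Circle.exp t) n) 0 (1 : ℝ)⟩ : TangentBundle (𝓡 3) N)) := by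
  set Θ : ℝ × N → N := fun p => θ (Circle.exp p.1) p.2 with hΘ
  have hΘs : ContMDiff (𝓘(ℝ, ℝ).prod (𝓡 3)) (𝓡 3) ∞ Θ :=
    hθ.comp (((contMDiff_circleExp (m := ∞)).comp contMDiff_fst).prodMk contMDiff_snd)
  have hΘ0 : ∀ n, Θ (0, n) = n := fun n => by
    show θ (Circle.exp 0) n = n
    rw [Circle.exp_zero, h1]
  -- the smooth section `n ↦ ((0, n), (1, 0))` of `T(ℝ × N)` and the tangent map of `Θ` along it
  have hsec : ContMDiff (𝓡 3) (𝓘(ℝ, ℝ).prod (𝓡 3)).tangent ∞ (fun n : N =>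
      (⟨((0 : ℝ), n), (((1 : ℝ), (0 : EuclideanSpace ℝ (Fin 3))) : ℝ × EuclideanSpace ℝ (Fin 3))⟩ :
        TangentBundle (𝓘(ℝ, ℝ).prod (𝓡 3)) (ℝ × N))) := by
    -- assembled from the constant section of `Tℝ` and the zero section of `TN`
    have hτ : ContMDiff 𝓘(ℝ, ℝ) 𝓘(ℝ, ℝ).tangent ∞ (fun t : ℝ => (⟨t, (1 : ℝ)⟩ : TangentBundle 𝓘(ℝ, ℝ) ℝ)) :=
      contMDiff_vectorSpace_iff_contDiff.2 contDiff_const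
    have hzero : ContMDiff (𝓡 3) (𝓡 3).tangent ∞ (fun n : N => (⟨n, 0⟩ : TangentBundle (𝓡 3) N)) :=
      contMDiff_zeroSection ℝ (TangentSpace (𝓡 3) : N → Type _)
    have hpair : ContMDiff (𝓡 3) (𝓘(ℝ, ℝ).tangent.prod (𝓡 3).tangent) ∞
        (fun n : N => ((⟨(0 : ℝ), (1 : ℝ)⟩ : TangentBundle 𝓘(ℝ, ℝ) ℝ), (⟨n, 0⟩ : TangentBundle (𝓡 3) N))) :=
      ((hτ.comp contMDiff_const)).prodMk hzero
    have h := (contMDiff_equivTangentBundleProd_symm (I := 𝓘(ℝ, ℝ)) (M := ℝ) (I' := 𝓡 3) (M' := N)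
      (n := ∞)).comp hpair
    exact h.congr fun n => rfl
  have htan : ContMDiff (𝓡 3) (𝓡 3).tangent ∞ (fun n : N => tangentMap (𝓘(ℝ, ℝ).prod (𝓡 3)) (𝓡 3) Θ
      ⟨((0 : ℝ), n), (((1 : ℝ), (0 : EuclideanSpace ℝ (Fin 3))) : ℝ × EuclideanSpace ℝ (Fin 3))⟩) :=
    (hΘs.contMDiff_tangentMap le_rfl).comp hsec
  -- compare fibre coordinates in the trivialisation at `n₀`
  intro n₀
  have h2 := (contMDiffAt_totalSpace.1 (htan n₀)).2
  simp only [TangentBundle.trivializationAt_apply, tangentMap] at h2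
  rw [hΘ0 n₀] at h2
  rw [(trivializationAt (EuclideanSpace ℝ (Fin 3)) (TangentSpace (𝓡 3) : N → Type _) n₀).contMDiffAt_section_iff
    (FiberBundle.mem_baseSet_trivializationAt' n₀)]
  simp only [TangentBundle.trivializationAt_apply]
  refine h2.congr_of_eventuallyEq (Filter.Eventually.of_forall fun n => ?_)
  have hval : mfderiv 𝓘(ℝ, ℝ) (𝓡 3) (fun t : ℝ => θ (Circle.exp t) n) 0 (1 : ℝ) =
      mfderiv (𝓘(ℝ, ℝ).prod (𝓡 3)) (𝓡 3) Θ (0, n)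
        (((1 : ℝ), (0 : EuclideanSpace ℝ (Fin 3))) : ℝ × EuclideanSpace ℝ (Fin 3)) :=
    mfderiv_circleOrbit_eq_mfderiv_actionMap hθ n
  have key : ∀ (z : N) (_ : z = n) (w : EuclideanSpace ℝ (Fin 3)),
      fderivWithin ℝ ((chartAt (EuclideanSpace ℝ (Fin 3)) n₀).extend (𝓡 3) ∘
          ((chartAt (EuclideanSpace ℝ (Fin 3)) z).extend (𝓡 3)).symm) (range (𝓡 3))
          ((chartAt (EuclideanSpace ℝ (Fin 3)) z).extend (𝓡 3) z) w =
        fderivWithin ℝ ((chartAt (EuclideanSpace ℝ (Fin 3)) n₀).extend (𝓡 3) ∘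
          ((chartAt (EuclideanSpace ℝ (Fin 3)) n).extend (𝓡 3)).symm) (range (𝓡 3))
          ((chartAt (EuclideanSpace ℝ (Fin 3)) n).extend (𝓡 3) n) w := by
    intro z hz w
    subst hz
    rfl
  beta_reduce
  refine (congrArg _ hval).trans ?_
  exact (key (Θ (0, n)) (hΘ0 n) _).symm

end OrbitField


/-! ### The first-order coefficient on the orbit direction as a continuous function; its sign -/

section Sign

universe u

variable {M : Type u} [TopologicalSpace M] [T2Space M] [CompactSpace M]
  [ChartedSpace (EuclideanSpace ℝ (Fin 4)) M] [IsManifold (𝓡 4) ∞ M]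
variable {N : Type} [TopologicalSpace N] [ChartedSpace (EuclideanSpace ℝ (Fin 3)) N]
  [IsManifold (𝓡 3) ∞ N] {j : N → M} {s : MForm (𝓡 4) M ℝ 2}

omit [T2Space M] [CompactSpace M] [IsManifold (𝓡 3) ∞ N] in
/-- The derivative in `t` of a `C^∞` function on `N × ℝ` along the line over `n` is its
manifold derivative on `(0, 1)`. [folklore] -/
theorem deriv_eq_mfderiv_prod_real {F : N × ℝ → ℝ} (hF : ContMDiff ((𝓡 3).prod 𝓘(ℝ, ℝ)) 𝓘(ℝ, ℝ) ∞ F)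
    (n : N) (t : ℝ) :
    deriv (fun t : ℝ => F (n, t)) t =
      mfderiv ((𝓡 3).prod 𝓘(ℝ, ℝ)) 𝓘(ℝ, ℝ) F (n, t) (((0 : EuclideanSpace ℝ (Fin 3)), (1 : ℝ)) :
        EuclideanSpace ℝ (Fin 3) × ℝ) := by
  have hι : HasMFDerivAt 𝓘(ℝ, ℝ) ((𝓡 3).prod 𝓘(ℝ, ℝ)) (fun t : ℝ => ((n, t) : N × ℝ)) t
      ((0 : ℝ →L[ℝ] EuclideanSpace ℝ (Fin 3)).prod (ContinuousLinearMap.id ℝ ℝ)) :=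
    (hasMFDerivAt_const n t).prodMk (hasMFDerivAt_id t)
  have hFd : MDifferentiableAt ((𝓡 3).prod 𝓘(ℝ, ℝ)) 𝓘(ℝ, ℝ) F (n, t) := hF.mdifferentiableAt (by norm_num)
  have hcomp := hFd.hasMFDerivAt.comp t hι
  have h3 : HasFDerivAt (fun t : ℝ => F (n, t))
      (((mfderiv ((𝓡 3).prod 𝓘(ℝ, ℝ)) 𝓘(ℝ, ℝ) F (n, t)).comp
        ((0 : ℝ →L[ℝ] EuclideanSpace ℝ (Fin 3)).prod (ContinuousLinearMap.id ℝ ℝ))) : ℝ →L[ℝ] ℝ) t :=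
    hasMFDerivAt_iff_hasFDerivAt.1 hcomp
  have hval : ((((mfderiv ((𝓡 3).prod 𝓘(ℝ, ℝ)) 𝓘(ℝ, ℝ) F (n, t)).comp
        ((0 : ℝ →L[ℝ] EuclideanSpace ℝ (Fin 3)).prod (ContinuousLinearMap.id ℝ ℝ))) : ℝ →L[ℝ] ℝ)) =
      (1 : ℝ →L[ℝ] ℝ).smulRight
        (mfderiv ((𝓡 3).prod 𝓘(ℝ, ℝ)) 𝓘(ℝ, ℝ) F (n, t) (((0 : EuclideanSpace ℝ (Fin 3)), (1 : ℝ)) :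
          EuclideanSpace ℝ (Fin 3) × ℝ)) := by
    apply ContinuousLinearMap.ext_ring
    show mfderiv ((𝓡 3).prod 𝓘(ℝ, ℝ)) 𝓘(ℝ, ℝ) F (n, t)
        (((0 : ℝ →L[ℝ] EuclideanSpace ℝ (Fin 3)).prod (ContinuousLinearMap.id ℝ ℝ)) (1 : ℝ)) =
      ((1 : ℝ →L[ℝ] ℝ) (1 : ℝ)) • mfderiv ((𝓡 3).prod 𝓘(ℝ, ℝ)) 𝓘(ℝ, ℝ) F (n, t)
        (((0 : EuclideanSpace ℝ (Fin 3)), (1 : ℝ)) : EuclideanSpace ℝ (Fin 3) × ℝ)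
    have e1 : ((0 : ℝ →L[ℝ] EuclideanSpace ℝ (Fin 3)).prod (ContinuousLinearMap.id ℝ ℝ)) (1 : ℝ) =
        (((0 : EuclideanSpace ℝ (Fin 3)), (1 : ℝ)) : EuclideanSpace ℝ (Fin 3) × ℝ) := rfl
    have e2 : ((1 : ℝ →L[ℝ] ℝ) (1 : ℝ)) = 1 := rfl
    rw [e1, e2, one_smul]
  have hD : HasDerivAt (fun t : ℝ => F (n, t))
      (mfderiv ((𝓡 3).prod 𝓘(ℝ, ℝ)) 𝓘(ℝ, ℝ) F (n, t) (((0 : EuclideanSpace ℝ (Fin 3)), (1 : ℝ)) :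
        EuclideanSpace ℝ (Fin 3) × ℝ)) t :=
    hasDerivAt_iff_hasFDerivAt.2 (h3.congr_fderiv hval)
  exact hD.deriv

/-- **The first-order coefficient on the orbit direction, `n ↦ B₁(X_n)`, is continuous** (indeed
`C^∞`): it is the manifold derivative on `∂ₜ` along `N × {0}` of the `C^∞` function
`(n, t) ↦ (c^*ω)_{(n,t)}(∂ₜ, X̃)`, a smooth form evaluated on two smooth vector fields of
`N × ℝ` (`ManifoldFormsEval.lean`; the fields `∂ₜ = (0, 1)` and `X̃ = (X_n, 0)` are smooth by
`contMDiff_prodSection`, `contMDiff_circleOrbit_section`).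
[cite: CannasdasilvaGuilleminPires2010, proof of Prop. 2.8] -/
theorem continuous_deriv_pullback_foldCollar_orbit (h : IsFoldedForm s N j)
    {θ : Circle → N → N}
    (hθ : ContMDiff ((𝓡 1).prod (𝓡 3)) (𝓡 3) ∞ (fun p : Circle × N => θ p.1 p.2))
    (h1 : ∀ n, θ 1 n = n) {f : M → ℝ} (U : LevelUnitField 3 f 0) :
    Continuous fun n : N => deriv (fun t : ℝ => (s.pullback ((𝓡 3).prod 𝓘(ℝ, ℝ)) (foldCollar U j)) (n, t)
      ![((0 : EuclideanSpace ℝ (Fin 3)), (1 : ℝ)),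
        ((mfderiv 𝓘(ℝ, ℝ) (𝓡 3) (fun t : ℝ => θ (Circle.exp t) n) 0 (1 : ℝ) :
          EuclideanSpace ℝ (Fin 3)), (0 : ℝ))]) 0 := by
  have hj : ContMDiff (𝓡 3) (𝓡 4) ∞ j := h.embedding.contMDiff
  set Ω := s.pullback ((𝓡 3).prod 𝓘(ℝ, ℝ)) (foldCollar U j) with hΩ
  have hΩs : IsSmoothForm Ω := isSmoothForm_pullback_foldCollar U hj h.smooth
  -- the two vector fields on `N × ℝ`
  have hX := contMDiff_circleOrbit_section hθ h1
  have hXt := contMDiff_prodSection (I := 𝓡 3) hX 0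
  have h0t := contMDiff_prodSection (I := 𝓡 3)
    (contMDiff_zeroSection ℝ (TangentSpace (𝓡 3) : N → Type _)) 1
  -- the smooth function `F(n,t) = Ω (∂ₜ, X̃)`
  set F : N × ℝ → ℝ := fun p => Ω p
    ![(((0 : EuclideanSpace ℝ (Fin 3)), (1 : ℝ)) : EuclideanSpace ℝ (Fin 3) × ℝ),
      ((mfderiv 𝓘(ℝ, ℝ) (𝓡 3) (fun t : ℝ => θ (Circle.exp t) p.1) 0 (1 : ℝ) :
        EuclideanSpace ℝ (Fin 3)), (0 : ℝ))] with hFdef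
  have hF : ContMDiff ((𝓡 3).prod 𝓘(ℝ, ℝ)) 𝓘(ℝ, ℝ) ∞ F := by
    have := hΩs.contMDiff_apply_sections
      (V := ![fun p : N × ℝ => ((((0 : EuclideanSpace ℝ (Fin 3)), (1 : ℝ)) :
          EuclideanSpace ℝ (Fin 3) × ℝ) : TangentSpace ((𝓡 3).prod 𝓘(ℝ, ℝ)) p),
        fun p : N × ℝ => ((((mfderiv 𝓘(ℝ, ℝ) (𝓡 3) (fun t : ℝ => θ (Circle.exp t) p.1) 0 (1 : ℝ) :
          EuclideanSpace ℝ (Fin 3)), (0 : ℝ)) : EuclideanSpace ℝ (Fin 3) × ℝ) :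
            TangentSpace ((𝓡 3).prod 𝓘(ℝ, ℝ)) p)]) (fun i => by
        fin_cases i
        · exact h0t
        · exact hXt)
    refine this.congr fun p => ?_
    show Ω p _ = Ω p _
    congr 1
    funext i
    fin_cases i <;> rfl
  -- its derivative on `∂ₜ` is smooth, and restricts to the function of the statement
  have hdF : ContMDiff ((𝓡 3).prod 𝓘(ℝ, ℝ)) 𝓘(ℝ, ℝ) ∞ (fun p : N × ℝ =>
      mlineDeriv ((𝓡 3).prod 𝓘(ℝ, ℝ)) F p
        ((((0 : EuclideanSpace ℝ (Fin 3)), (1 : ℝ)) : EuclideanSpace ℝ (Fin 3) × ℝ))) :=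
    contMDiff_mlineDeriv_section hF h0t
  have hline : ContMDiff (𝓡 3) ((𝓡 3).prod 𝓘(ℝ, ℝ)) ∞ (fun n : N => ((n, (0 : ℝ)) : N × ℝ)) :=
    contMDiff_id.prodMk contMDiff_const
  have hcont := (hdF.comp hline).continuous
  refine hcont.congr fun n => ?_
  show mlineDeriv ((𝓡 3).prod 𝓘(ℝ, ℝ)) F (n, 0) _ = _
  rw [mlineDeriv_def, ← deriv_eq_mfderiv_prod_real hF n 0]

variable [PreconnectedSpace N]

/-- **Constant sign of `B₁(X)` on a connected fold.** For fold data `(N, j, θ)` of an origami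
form on a compact 4-manifold with `N` (pre)connected, a function `f` vanishing on the fold and a
kernel-adapted unit field `U`, the first-order coefficient `n ↦ ∂ₜ|₀ (c^*ω)_{(n,t)}((0,1),(X_n,0))`
is either everywhere positive or everywhere negative (it is continuous and never zero).
[cite: CannasdasilvaGuilleminPires2010, Def. 2.2 and proof of Prop. 2.8] -/
theorem IsFoldedForm.deriv_pullback_foldCollar_orbit_pos_or_neg (h : IsFoldedForm s N j)
    {θ : Circle → N → N}
    (hθ : ContMDiff ((𝓡 1).prod (𝓡 3)) (𝓡 3) ∞ (fun p : Circle × N => θ p.1 p.2))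
    (h1 : ∀ n, θ 1 n = n) (hmul : ∀ a b n, θ (a * b) n = θ a (θ b n))
    (hfree : ∀ a n, θ a n = n → a = 1)
    (htan : ∀ (n : N) (w : TangentSpace (𝓡 4) (j n)),
      s (j n) ![mfderiv 𝓘(ℝ, ℝ) (𝓡 4) (fun t : ℝ => j (θ (Circle.exp t) n)) 0 (1 : ℝ), w] = 0)
    {f : M → ℝ} (U : LevelUnitField 3 f 0) (hf0 : ∀ x ∈ fold s, f x = 0)
    (hU : ∀ x ∈ fold s, ∀ w : TangentSpace (𝓡 4) x, s x ![U.ξ x, w] = 0) :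
    (∀ n : N, 0 < deriv (fun t : ℝ => (s.pullback ((𝓡 3).prod 𝓘(ℝ, ℝ)) (foldCollar U j)) (n, t)
      ![((0 : EuclideanSpace ℝ (Fin 3)), (1 : ℝ)),
        ((mfderiv 𝓘(ℝ, ℝ) (𝓡 3) (fun t : ℝ => θ (Circle.exp t) n) 0 (1 : ℝ) :
          EuclideanSpace ℝ (Fin 3)), (0 : ℝ))]) 0) ∨
    (∀ n : N, deriv (fun t : ℝ => (s.pullback ((𝓡 3).prod 𝓘(ℝ, ℝ)) (foldCollar U j)) (n, t)
      ![((0 : EuclideanSpace ℝ (Fin 3)), (1 : ℝ)),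
        ((mfderiv 𝓘(ℝ, ℝ) (𝓡 3) (fun t : ℝ => θ (Circle.exp t) n) 0 (1 : ℝ) :
          EuclideanSpace ℝ (Fin 3)), (0 : ℝ))]) 0 < 0) := by
  set g : N → ℝ := fun n => deriv (fun t : ℝ => (s.pullback ((𝓡 3).prod 𝓘(ℝ, ℝ)) (foldCollar U j)) (n, t)
      ![((0 : EuclideanSpace ℝ (Fin 3)), (1 : ℝ)),
        ((mfderiv 𝓘(ℝ, ℝ) (𝓡 3) (fun t : ℝ => θ (Circle.exp t) n) 0 (1 : ℝ) :
          EuclideanSpace ℝ (Fin 3)), (0 : ℝ))]) 0 with hg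
  have hgc : Continuous g := continuous_deriv_pullback_foldCollar_orbit h hθ h1 U
  have hg0 : ∀ n, g n ≠ 0 := fun n =>
    h.deriv_pullback_foldCollar_orbit_ne_zero hθ h1 hmul hfree htan U hf0 hU n
  by_contra hcon
  push Not at hcon
  obtain ⟨⟨a, ha⟩, ⟨b, hb⟩⟩ := hcon
  have ha' : g a < 0 := lt_of_le_of_ne ha (hg0 a)
  have hb' : 0 < g b := lt_of_le_of_ne hb (fun h0 => hg0 b h0.symm)
  obtain ⟨x, hx⟩ := intermediate_value_univ₂ (f := g) (g := fun _ => (0 : ℝ)) hgc continuous_const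
    ha'.le hb'.le
  exact hg0 x hx

end Sign


/-! ### Reversing the circle action flips the sign -/

section Flip

universe u

variable {M : Type u} [TopologicalSpace M] [T2Space M] [CompactSpace M]
  [ChartedSpace (EuclideanSpace ℝ (Fin 4)) M] [IsManifold (𝓡 4) ∞ M]
variable {N : Type} [TopologicalSpace N] [ChartedSpace (EuclideanSpace ℝ (Fin 3)) N]
  [IsManifold (𝓡 3) ∞ N] {j : N → M} {s : MForm (𝓡 4) M ℝ 2}

omit [IsManifold (𝓡 3) ∞ N] in
/-- **The reversed action** `(a, n) ↦ θ(a⁻¹) n` of a smooth free circle action is a smooth free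
circle action with the same orbits. [folklore] -/
theorem circleAct_inv_free {θ : Circle → N → N}
    (hθ : ContMDiff ((𝓡 1).prod (𝓡 3)) (𝓡 3) ∞ (fun p : Circle × N => θ p.1 p.2))
    (h1 : ∀ n, θ 1 n = n) (hmul : ∀ a b n, θ (a * b) n = θ a (θ b n))
    (hfree : ∀ a n, θ a n = n → a = 1) :
    ContMDiff ((𝓡 1).prod (𝓡 3)) (𝓡 3) ∞ (fun p : Circle × N => θ p.1⁻¹ p.2) ∧
      (∀ n, θ (1 : Circle)⁻¹ n = n) ∧ (∀ a b n, θ (a * b)⁻¹ n = θ a⁻¹ (θ b⁻¹ n)) ∧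
      (∀ a n, θ a⁻¹ n = n → a = 1) := by
  refine ⟨?_, fun n => by rw [inv_one, h1], fun a b n => by rw [mul_inv_rev, mul_comm, hmul],
    fun a n h => inv_eq_one.1 (hfree a⁻¹ n h)⟩
  have hinv : ContMDiff ((𝓡 1).prod (𝓡 3)) ((𝓡 1).prod (𝓡 3)) ∞
      (fun p : Circle × N => ((p.1⁻¹, p.2) : Circle × N)) :=
    ((contMDiff_inv (𝓡 1) ∞).comp contMDiff_fst).prodMk contMDiff_snd
  exact hθ.comp hinv

omit [IsManifold (𝓡 3) ∞ N] in
/-- The orbit velocity of the reversed action is the negative of the orbit velocity. [folklore] -/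
theorem mfderiv_circleOrbit_inv {θ : Circle → N → N}
    (hθ : ContMDiff ((𝓡 1).prod (𝓡 3)) (𝓡 3) ∞ (fun p : Circle × N => θ p.1 p.2)) (n : N) :
    mfderiv 𝓘(ℝ, ℝ) (𝓡 3) (fun t : ℝ => θ (Circle.exp t)⁻¹ n) 0 (1 : ℝ) =
      -mfderiv 𝓘(ℝ, ℝ) (𝓡 3) (fun t : ℝ => θ (Circle.exp t) n) 0 (1 : ℝ) := by
  have heq : (fun t : ℝ => θ (Circle.exp t)⁻¹ n) = (fun t : ℝ => θ (Circle.exp t) n) ∘ (fun t : ℝ => -t) := by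
    funext t
    simp only [Function.comp_apply, Circle.exp_neg]
  have hγ : MDifferentiableAt 𝓘(ℝ, ℝ) (𝓡 3) (fun t : ℝ => θ (Circle.exp t) n) 0 :=
    (Literature.Geometry.Manifold.contMDiff_circleOrbit hθ n).mdifferentiableAt (by norm_num)
  have hneg : HasMFDerivAt 𝓘(ℝ, ℝ) 𝓘(ℝ, ℝ) (fun t : ℝ => -t) 0 (-(ContinuousLinearMap.id ℝ ℝ)) :=
    ((hasFDerivAt_id (0 : ℝ)).neg).hasMFDerivAt
  have hγ' : HasMFDerivAt 𝓘(ℝ, ℝ) (𝓡 3) (fun t : ℝ => θ (Circle.exp t) n) ((fun t : ℝ => -t) 0)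
      (mfderiv 𝓘(ℝ, ℝ) (𝓡 3) (fun t : ℝ => θ (Circle.exp t) n) 0) := by
    rw [show (fun t : ℝ => -t) 0 = (0 : ℝ) from neg_zero]
    exact hγ.hasMFDerivAt
  have hcomp := hγ'.comp 0 hneg
  rw [heq, hcomp.mfderiv]
  show mfderiv 𝓘(ℝ, ℝ) (𝓡 3) (fun t : ℝ => θ (Circle.exp t) n) 0 (-(1 : ℝ)) = _
  exact map_neg _ _

omit [T2Space M] [CompactSpace M] [IsManifold (𝓡 4) ∞ M] [IsManifold (𝓡 3) ∞ N] in
/-- Negating the second vector negates the coefficient function (linearity of `2`-forms).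
[folklore] -/
theorem deriv_pullback_neg_vector (Ω : MForm ((𝓡 3).prod 𝓘(ℝ, ℝ)) (N × ℝ) ℝ 2) (n : N)
    (a b : EuclideanSpace ℝ (Fin 3) × ℝ) :
    deriv (fun t : ℝ => Ω (n, t) ![a, -b]) 0 = -deriv (fun t : ℝ => Ω (n, t) ![a, b]) 0 := by
  have hfun : (fun t : ℝ => Ω (n, t) ![a, -b]) = -(fun t : ℝ => Ω (n, t) ![a, b]) := by
    funext t
    simp only [Pi.neg_apply]
    exact cam₂_neg_right (Ω (n, t)) a b
  rw [hfun, deriv.neg]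

variable [PreconnectedSpace N]

/-- **Orientation of the null fibration making `B₁(X)` positive** (the convention of Def. 2.2:
"we assume that the principal `S¹`-action matches the induced orientation of the null
foliation"): on a connected fold, either the given free circle action or its reverse
`(a, n) ↦ θ(a⁻¹) n` (again a free smooth action tangent to `ker ω`) has everywhere POSITIVE
first-order coefficient on its orbit velocity. [cite: CannasdasilvaGuilleminPires2010, Def. 2.2 and proof of Prop. 2.8] -/
theorem IsFoldedForm.deriv_pullback_foldCollar_orbit_pos_or_inv_pos (h : IsFoldedForm s N j)
    {θ : Circle → N → N}
    (hθ : ContMDiff ((𝓡 1).prod (𝓡 3)) (𝓡 3) ∞ (fun p : Circle × N => θ p.1 p.2))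
    (h1 : ∀ n, θ 1 n = n) (hmul : ∀ a b n, θ (a * b) n = θ a (θ b n))
    (hfree : ∀ a n, θ a n = n → a = 1)
    (htan : ∀ (n : N) (w : TangentSpace (𝓡 4) (j n)),
      s (j n) ![mfderiv 𝓘(ℝ, ℝ) (𝓡 4) (fun t : ℝ => j (θ (Circle.exp t) n)) 0 (1 : ℝ), w] = 0)
    {f : M → ℝ} (U : LevelUnitField 3 f 0) (hf0 : ∀ x ∈ fold s, f x = 0)
    (hU : ∀ x ∈ fold s, ∀ w : TangentSpace (𝓡 4) x, s x ![U.ξ x, w] = 0) :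
    (∀ n : N, 0 < deriv (fun t : ℝ => (s.pullback ((𝓡 3).prod 𝓘(ℝ, ℝ)) (foldCollar U j)) (n, t)
      ![((0 : EuclideanSpace ℝ (Fin 3)), (1 : ℝ)),
        ((mfderiv 𝓘(ℝ, ℝ) (𝓡 3) (fun t : ℝ => θ (Circle.exp t) n) 0 (1 : ℝ) :
          EuclideanSpace ℝ (Fin 3)), (0 : ℝ))]) 0) ∨
    (∀ n : N, 0 < deriv (fun t : ℝ => (s.pullback ((𝓡 3).prod 𝓘(ℝ, ℝ)) (foldCollar U j)) (n, t)
      ![((0 : EuclideanSpace ℝ (Fin 3)), (1 : ℝ)),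
        ((mfderiv 𝓘(ℝ, ℝ) (𝓡 3) (fun t : ℝ => θ (Circle.exp t)⁻¹ n) 0 (1 : ℝ) :
          EuclideanSpace ℝ (Fin 3)), (0 : ℝ))]) 0) := by
  rcases h.deriv_pullback_foldCollar_orbit_pos_or_neg hθ h1 hmul hfree htan U hf0 hU with hpos | hneg
  · exact Or.inl hpos
  · refine Or.inr fun n => ?_
    have hv : ((mfderiv 𝓘(ℝ, ℝ) (𝓡 3) (fun t : ℝ => θ (Circle.exp t)⁻¹ n) 0 (1 : ℝ) :
        EuclideanSpace ℝ (Fin 3)), (0 : ℝ)) =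
        -(((mfderiv 𝓘(ℝ, ℝ) (𝓡 3) (fun t : ℝ => θ (Circle.exp t) n) 0 (1 : ℝ) :
          EuclideanSpace ℝ (Fin 3)), (0 : ℝ)) : EuclideanSpace ℝ (Fin 3) × ℝ) := by
      rw [mfderiv_circleOrbit_inv hθ n, Prod.neg_mk, neg_zero]
      rfl
    have hfun : (fun t : ℝ => (s.pullback ((𝓡 3).prod 𝓘(ℝ, ℝ)) (foldCollar U j)) (n, t)
        ![((0 : EuclideanSpace ℝ (Fin 3)), (1 : ℝ)),
          ((mfderiv 𝓘(ℝ, ℝ) (𝓡 3) (fun t : ℝ => θ (Circle.exp t)⁻¹ n) 0 (1 : ℝ) :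
            EuclideanSpace ℝ (Fin 3)), (0 : ℝ))]) =
        fun t : ℝ => (s.pullback ((𝓡 3).prod 𝓘(ℝ, ℝ)) (foldCollar U j)) (n, t)
          ![((0 : EuclideanSpace ℝ (Fin 3)), (1 : ℝ)),
            -(((mfderiv 𝓘(ℝ, ℝ) (𝓡 3) (fun t : ℝ => θ (Circle.exp t) n) 0 (1 : ℝ) :
              EuclideanSpace ℝ (Fin 3)), (0 : ℝ)) : EuclideanSpace ℝ (Fin 3) × ℝ)] :=
      funext fun t => congrArg (fun v : EuclideanSpace ℝ (Fin 3) × ℝ =>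
        (s.pullback ((𝓡 3).prod 𝓘(ℝ, ℝ)) (foldCollar U j)) (n, t)
          ![((0 : EuclideanSpace ℝ (Fin 3)), (1 : ℝ)), v]) hv
    have key := (congrArg (fun F : ℝ → ℝ => deriv F 0) hfun).trans
      (deriv_pullback_neg_vector (s.pullback ((𝓡 3).prod 𝓘(ℝ, ℝ)) (foldCollar U j)) n _ _)
    have hlt : 0 < -deriv (fun t : ℝ => (s.pullback ((𝓡 3).prod 𝓘(ℝ, ℝ)) (foldCollar U j)) (n, t)
        ![((0 : EuclideanSpace ℝ (Fin 3)), (1 : ℝ)),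
          ((mfderiv 𝓘(ℝ, ℝ) (𝓡 3) (fun t : ℝ => θ (Circle.exp t) n) 0 (1 : ℝ) :
            EuclideanSpace ℝ (Fin 3)), (0 : ℝ))]) 0 := by linarith [hneg n]
    exact key ▸ hlt

end Flip

end Literature.Geometry.Symplectic

end
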